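import Literature.IUT.LogVolume.IsometryGaloisOrder
import Literature.IUT.LogVolume.IsometryMoverAscent
import Literature.IUT.LogVolume.IntegralBases
import HarnessLib

/-!
# TAME ⟺ a norm-unimodular trace-dual pair: orthogonal bases of a `p`-adic field and the Dedekind criterion at every tame Galois field

abc-iut cell, seat abc-iut-E-t42 (gen 4; rung LADDER-ABC:A2.RESCUE.J, R-J row Y-29b «dividing line of the isometric (Ind2)»).  PROOF-ONLY
classical non-archimedean linear algebra (Weil, *Basic Number Theory* II §1; Serre, *Local Fields* III §3); no definition, no `Prop` fact,
no `sorry`.  Sequel of `IsometryGaloisOrder.lean` (p462048): its hypothesis «a trace-dual pair of `ℚ_p`-bases `(b, d)` with `‖b_i‖·‖d_i‖ ≤ 1`»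
is shown EQUIVALENT to the negation of the WILD hypothesis `∀ x, ‖x‖ ≤ 1 → ‖Tr_{K/ℚ_p} x‖ < 1` of the cell's negative half
(`Summit.ABC.IUTFork.Joshi.PinsIsometricShear.not_pinnedRegions_honestSetting_of_isometries_of_wild`, p457646) — so the two kernel halves of
row Y-29b's dividing line are now stated on the SAME axis: `hwild` versus `¬ hwild` (i.e. `Tr(𝒪_K) = ℤ_p`, tame ramification).

* §1 `TameDualPair.exists_dominated_family`, **`exists_dominated_basis`** — every finite-dimensional ultrametric normed `ℚ_p`-space has an
  ORTHOGONAL basis `b` (`‖x_i·b_i‖ ≤ ‖x‖` coordinatewise), by adjoining best-approximation residuals (abc-iut-E-t7's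
  `MoverAscent.exists_orthogonal_of_ne_top`);
* §2 **`exists_normUnimodular_dualPair_of_not_wild`** — `¬ hwild ⟹` the trace dual `d` of an orthogonal basis `b` (campaign-S
  `exists_traceDual_basis`) has `‖b_i‖·‖d_i‖ ≤ 1`: otherwise every integer `w` has `Tr w = [w/d_i]_i` of norm `≤ ‖w‖/(‖b_i‖‖d_i‖) < 1`;
  **`exists_galoisOrder_repr_of_isometry_of_not_wild`** — hence, for `K/ℚ_p` GALOIS and not wild, EVERY `ℚ_p`-linear isometry `g` has `g`,
  `g⁻¹ ∈ 𝒪_K⟨Gal(K/ℚ_p)⟩` with integral Dedekind coefficients (the `hIsmG` shape of the cell's `PinsGaloisOrder`, p460152);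
  `exists_normUnimodular_dualPair_iff_not_wild` — the equivalence (⟹ is p462048's `not_forall_norm_trace_lt_one_of_dualPair`).

Nothing here is disputed mathematics; the consumer rows are the cell's typings [claim: Mochizuki2012, status: disputed] of (Ind2).
[cite: WeilBNT1967, Ch. II §1, Prop. 2–3] [cite: SerreLocalFields1979, Ch. III §3, Prop. 7] [cite: NeukirchANT1999, Ch. II (4.8)]
-/

noncomputable section

open Module

namespace Literature.IUT.LogVolume

namespace TameDualPair

/-! ## §1 Norm-dominated (orthogonal) bases of a finite-dimensional ultrametric `ℚ_p`-space -/

section Dominated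

variable {p : ℕ} [Fact p.Prime]
variable {E : Type} [NormedAddCommGroup E] [NormedSpace ℚ_[p] E] [IsUltrametricDist E] [FiniteDimensional ℚ_[p] E]

/-- **Norm-dominated families of every length `k ≤ dim E`**: nonzero vectors `w_0, …, w_{k−1}` with
`‖c_i·w_i‖ ≤ ‖Σ_j c_j·w_j‖` for all coefficients (an ORTHOGONAL family: `‖Σ c_j w_j‖ = max ‖c_j w_j‖`), built by adjoining to
`w_0, …, w_{k−1}` a vector orthogonal to their span (abc-iut-E-t7's `MoverAscent.exists_orthogonal_of_ne_top`: best approximation in a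
proper ultrametric space). [cite: WeilBNT1967, Ch. II §1, Prop. 2–3] -/
theorem exists_dominated_family (k : ℕ) (hk : k ≤ finrank ℚ_[p] E) :
    ∃ w : Fin k → E, (∀ i, w i ≠ 0) ∧ ∀ (c : Fin k → ℚ_[p]) (i : Fin k), ‖c i • w i‖ ≤ ‖∑ j, c j • w j‖ := by
  induction k with
  | zero => exact ⟨Fin.elim0, fun i => i.elim0, fun _ i => i.elim0⟩
  | succ k ih =>
    obtain ⟨w, hw0, hw⟩ := ih ((Nat.le_succ k).trans hk)
    set S : Submodule ℚ_[p] E := Submodule.span ℚ_[p] (Set.range w) with hS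
    have hSne : S ≠ ⊤ := by
      intro h
      have h1 : finrank ℚ_[p] S ≤ k := by
        have h2 : Set.finrank ℚ_[p] (Set.range w) ≤ Fintype.card (Fin k) := finrank_range_le_card w
        rwa [Fintype.card_fin] at h2
      rw [h, finrank_top] at h1
      omega
    obtain ⟨u, huS, hu⟩ := MoverAscent.exists_orthogonal_of_ne_top S hSne
    have hu0 : u ≠ 0 := fun h => huS (h ▸ S.zero_mem)
    refine ⟨Fin.snoc w u, fun i => ?_, fun c i => ?_⟩
    · refine Fin.lastCases ?_ (fun j => ?_) i
      · rwa [Fin.snoc_last]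
      · rw [Fin.snoc_castSucc]; exact hw0 j
    · have hsum : ∑ j, c j • (Fin.snoc w u : Fin (k + 1) → E) j =
          (∑ j : Fin k, c (Fin.castSucc j) • w j) + c (Fin.last k) • u := by
        rw [Fin.sum_univ_castSucc]
        simp only [Fin.snoc_castSucc, Fin.snoc_last]
      have hsS : (∑ j : Fin k, c (Fin.castSucc j) • w j) ∈ S :=
        S.sum_mem fun j _ => S.smul_mem _ (Submodule.subset_span ⟨j, rfl⟩)
      have hmax := MoverAscent.norm_add_smul_eq_max hu hsS (c (Fin.last k))
      rw [hsum, hmax]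
      refine Fin.lastCases ?_ (fun j => ?_) i
      · rw [Fin.snoc_last]; exact le_max_right _ _
      · rw [Fin.snoc_castSucc]; exact (hw (fun j => c (Fin.castSucc j)) j).trans (le_max_left _ _)

/-- **A norm-dominated basis**: a `ℚ_p`-basis `b` of `E` with `‖b.repr x i · b_i‖ ≤ ‖x‖` for every `x` and `i` (each coordinate term is
dominated by the vector — equivalently `‖x‖ = max_i ‖x_i b_i‖`). [cite: WeilBNT1967, Ch. II §1, Prop. 3] -/
theorem exists_dominated_basis :
    ∃ b : Basis (Fin (finrank ℚ_[p] E)) ℚ_[p] E, ∀ (x : E) (i : Fin (finrank ℚ_[p] E)), ‖b.repr x i • b i‖ ≤ ‖x‖ := by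
  obtain ⟨w, hw0, hw⟩ := exists_dominated_family (E := E) (finrank ℚ_[p] E) le_rfl
  have hli : LinearIndependent ℚ_[p] w := by
    refine Fintype.linearIndependent_iff.mpr fun c hc i => ?_
    have h := hw c i
    rw [hc, norm_zero] at h
    have h0 : c i • w i = 0 := norm_le_zero_iff.mp h
    exact (smul_eq_zero.mp h0).resolve_right (hw0 i)
  have hsp : ⊤ ≤ Submodule.span ℚ_[p] (Set.range w) :=
    (hli.span_eq_top_of_card_eq_finrank' (by rw [Fintype.card_fin])).ge
  let b := Basis.mk hli hsp
  have hb : ⇑b = w := Basis.coe_mk hli hsp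
  refine ⟨b, fun x i => ?_⟩
  conv_rhs => rw [← b.sum_repr x]
  rw [hb]
  exact hw (fun j => b.repr x j) i

end Dominated

/-! ## §2 A unit trace on the integers gives a NORM-UNIMODULAR trace-dual pair -/

section DualPair

variable {p : ℕ} [Fact p.Prime]
variable {K : Type} [NontriviallyNormedField K] [NormedAlgebra ℚ_[p] K] [IsUltrametricDist K] [ProperSpace K]

/-- **TAME ⟹ a norm-unimodular trace-dual pair.**  If the trace form is NOT wild — i.e. NOT `∀ x, ‖x‖ ≤ 1 → ‖Tr x‖ < 1`, the hypothesis
`hwild` of the cell's negative half `PinsIsometricShear.not_pinnedRegions_honestSetting_of_isometries_of_wild` (p457646); equivalently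
`Tr_{K/ℚ_p}(𝒪_K) = ℤ_p`, i.e. `K/ℚ_p` tamely ramified — then `K` has `ℚ_p`-bases `b`, `d` with `Tr(d_i b_j) = δ_{ij}` and `‖b_i‖·‖d_i‖ ≤ 1`:
take `b` norm-dominated (§1) and `d` its trace dual (campaign-S `exists_traceDual_basis`); if `‖b_i‖·‖d_i‖ > 1` then for every integer
`w`, `Tr w = Tr(d_i · w/d_i)` is the `i`-th coordinate of `w/d_i`, of norm `≤ ‖w/d_i‖/‖b_i‖ < ‖w‖ ≤ 1` — the trace would be wild.
[cite: SerreLocalFields1979, Ch. III §3, Prop. 7] [cite: WeilBNT1967, Ch. II §1, Prop. 3] -/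
theorem exists_normUnimodular_dualPair_of_not_wild (h : ¬ ∀ x : K, ‖x‖ ≤ 1 → ‖Algebra.trace ℚ_[p] K x‖ < 1) :
    ∃ (n : ℕ) (b d : Basis (Fin n) ℚ_[p] K),
      (∀ i j, Algebra.trace ℚ_[p] K (d i * b j) = if j = i then 1 else 0) ∧ ∀ i, ‖b i‖ * ‖d i‖ ≤ 1 := by
  classical
  push Not at h
  obtain ⟨w, hw1, hwtr⟩ := h
  haveI := finiteDimensional p K
  obtain ⟨b, hb⟩ := exists_dominated_basis (p := p) (E := K)
  obtain ⟨d, hbd⟩ := exists_traceDual_basis (p := p) b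
  refine ⟨finrank ℚ_[p] K, b, d, hbd, fun i => ?_⟩
  by_contra H
  rw [not_le] at H
  have hd0 : d i ≠ 0 := d.ne_zero i
  have hdpos : 0 < ‖d i‖ := norm_pos_iff.mpr hd0
  -- `x := w / d_i` has `i`-th coordinate `Tr(x d_i) = Tr w`
  set x : K := w * (d i)⁻¹ with hx
  have hxi : b.repr x i = Algebra.trace ℚ_[p] K w := by
    rw [dualPair_repr_left b d hbd x i, hx, inv_mul_cancel_right₀ hd0]
  have h1 : ‖Algebra.trace ℚ_[p] K w‖ * ‖b i‖ ≤ ‖d i‖⁻¹ := by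
    have h := hb x i
    rw [hxi, norm_smul, hx, norm_mul, norm_inv] at h
    exact h.trans (mul_le_of_le_one_left (inv_nonneg.mpr (norm_nonneg _)) hw1)
  have h2 : ‖Algebra.trace ℚ_[p] K w‖ * (‖b i‖ * ‖d i‖) ≤ 1 := by
    rw [← mul_assoc]
    calc ‖Algebra.trace ℚ_[p] K w‖ * ‖b i‖ * ‖d i‖ ≤ ‖d i‖⁻¹ * ‖d i‖ := by gcongr
      _ = 1 := inv_mul_cancel₀ hdpos.ne'
  have h3 : ‖Algebra.trace ℚ_[p] K w‖ < 1 := by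
    by_contra h4
    rw [not_lt] at h4
    have : 1 * (‖b i‖ * ‖d i‖) ≤ 1 := (mul_le_mul_of_nonneg_right h4 (by positivity)).trans h2
    rw [one_mul] at this
    exact absurd this (not_le.mpr H)
  exact absurd hwtr (not_le.mpr h3)

/-- **THE DIVIDING LINE ON THE FIELD AXIS (Galois case).**  For `K/ℚ_p` finite GALOIS: the trace form is NOT wild
(`¬ ∀ x, ‖x‖ ≤ 1 → ‖Tr x‖ < 1`, i.e. tame) ⟹ EVERY `ℚ_p`-linear isometry `g` of `K` has `g` and `g⁻¹` in the integral Galois order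
`𝒪_K⟨Gal(K/ℚ_p)⟩` with integral Dedekind coefficients — the `hIsmG` shape of the cell's
`Summit.ABC.IUTFork.Joshi.PinsGaloisOrder.exists_pinnedRegions_honestSetting_of_galoisOrderIsm` (p460152) for ALL isometries; whereas under
`hwild` (and `p` odd) the cell's p457646 exhibits an isometry OUTSIDE the order (it moves the maximal order of `K ⊗ K`).
[cite: SerreLocalFields1979, Ch. III §3, Prop. 7] [cite: NeukirchANT1999, Ch. II (4.8)] -/
theorem exists_galoisOrder_repr_of_isometry_of_not_wild [FiniteDimensional ℚ_[p] K] [IsGalois ℚ_[p] K]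
    (h : ¬ ∀ x : K, ‖x‖ ≤ 1 → ‖Algebra.trace ℚ_[p] K x‖ < 1) (g : K ≃ₗ[ℚ_[p]] K) (hg : ∀ x, ‖g x‖ = ‖x‖) :
    (∃ (T : Finset (K ≃ₐ[ℚ_[p]] K)) (c : (K ≃ₐ[ℚ_[p]] K) → K), (∀ τ ∈ T, ‖c τ‖ ≤ 1) ∧ ∀ x, g x = ∑ τ ∈ T, c τ * τ x) ∧
    (∃ (T : Finset (K ≃ₐ[ℚ_[p]] K)) (c : (K ≃ₐ[ℚ_[p]] K) → K), (∀ τ ∈ T, ‖c τ‖ ≤ 1) ∧ ∀ x, g.symm x = ∑ τ ∈ T, c τ * τ x) := by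
  obtain ⟨_, b, d, hbd, hnorm⟩ := exists_normUnimodular_dualPair_of_not_wild h
  exact exists_galoisOrder_repr_of_isometry b d hbd hnorm g hg

/-- **Equivalence**: for any `K`, a norm-unimodular trace-dual pair EXISTS iff the trace form is not wild (`⟸` above; `⟹` is
`not_forall_norm_trace_lt_one_of_dualPair` of `IsometryGaloisOrder.lean`). [cite: SerreLocalFields1979, Ch. III §3, Prop. 7] -/
theorem exists_normUnimodular_dualPair_iff_not_wild :
    (∃ (n : ℕ) (b d : Basis (Fin n) ℚ_[p] K),
      (∀ i j, Algebra.trace ℚ_[p] K (d i * b j) = if j = i then 1 else 0) ∧ ∀ i, ‖b i‖ * ‖d i‖ ≤ 1) ↔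
    ¬ ∀ x : K, ‖x‖ ≤ 1 → ‖Algebra.trace ℚ_[p] K x‖ < 1 := by
  refine ⟨fun ⟨n, b, d, hbd, hnorm⟩ => ?_, exists_normUnimodular_dualPair_of_not_wild⟩
  haveI := finiteDimensional p K
  haveI : Nonempty (Fin n) := by
    have hn : n = finrank ℚ_[p] K := by simpa using (finrank_eq_card_basis b).symm
    rw [hn]
    exact ⟨⟨0, finrank_pos⟩⟩
  exact not_forall_norm_trace_lt_one_of_dualPair b d hbd hnorm

end DualPair

end TameDualPair

end Literature.IUT.LogVolume

end
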